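import Summits.Langlands.Langlands.Theses.QuadraticWindow
import Literature.NumberTheory.Automorphic.UnitaryCoherentGaloisRep
import Literature.NumberTheory.Automorphic.ReciprocityGLnQlModelProofs
import Literature.NumberTheory.GaloisRepresentations.FramedRepBaseChange
import HarnessLib

/-!
# `GaloisRepOfUnitaryLDS` (stmt-Langlands-15129) — negative knowledge II: which stubs of the line
# `Sketch` carry falsity risk independent of the crux

Support lemmas of the standing disprover (`Cruxes/GaloisRepOfUnitaryLDS/Disproof.lean`, cycle 1,
§5), for the lead's line `Sketch` (card `hecke-algebra-valued-limit`; stubs P2 `stub_heckeFieldFinite`,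
P3 `stub_almostAllUnramified`, K2 `stub_regularDSGalois`, K1 `stub_regularShadows`,
K3 `stub_algebraValuedLimit`).  Two of the five stubs are IMPLIED BY THE CRUX itself, so a
refutation of either would refute the crux and neither adds falsity risk to the line:

* `heckeFieldFinite_of_galoisRepOfUnitaryLDS` — P2, i.e. the named fact
  `GoldringKoskivirta2019_heckeFieldFinite` (gate relocation of the stub), FOLLOWS from the crux:
  the crux's `r` has a model over a finite `E/ℚ_ℓ` (`exists_hasQlModel_holds`, proved in the
  tree), and Frobenius polynomials are invariant under the change of frame (`charpoly_conj`) and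
  commute with `E ⊆ ℚ̄_ℓ` (`FramedRep.charpoly_baseChange`).
* `regularCase_of_galoisRepOfUnitaryLDS` — K2 (verbatim the statement registered in
  `Cruxes/GaloisRepOfUnitaryLDS/Lines/Sketch.lean`: the crux with `d.IsRegular` added) follows from
  the crux by forgetting regularity.

The independent risk of the line therefore sits in P3 (Flath), K1 (the coherent-cohomology engine)
and K3 (the lead's algebra-valued limit theorem).  Nothing here asserts a route statement.
Mathlib + accepted tree only. [folklore]
-/

noncomputable section

-- single-conjunct summit `Summits/Langlands/Langlands` (D-0017): the doubled namespace is the tree's layout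
set_option linter.dupNamespace false

open scoped Polynomial Classical NumberField MatrixGroups Matrix
open Polynomial IsDedekindDomain NumberField
open Literature.NumberTheory.Automorphic Literature.NumberTheory.GaloisRepresentations
open Summit.Langlands.Langlands.Theses.QuadraticWindow (GaloisRepOfUnitaryLDS)

namespace Summit.Langlands.Langlands.Theorems.GaloisRepOfUnitaryLDS.Negative

/-- Characteristic polynomials are invariant under change of frame (Mathlib
`Matrix.charpoly_units_conj`). [folklore] -/
theorem charpoly_conj {G C : Type*} [Group G] [TopologicalSpace G] [CommRing C]
    [TopologicalSpace C] [IsTopologicalRing C] {n : ℕ} (P : GL (Fin n) C) (ρ : FramedRep G C n)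
    (g : G) : FramedRep.charpoly (FramedRep.conj P ρ) g = FramedRep.charpoly ρ g := by
  simp only [FramedRep.charpoly, FramedRep.conj_apply, Units.val_mul, Matrix.coe_units_inv]
  exact Matrix.charpoly_units_conj P _

/-- **P2 is a corollary of the crux**: `GaloisRepOfUnitaryLDS → GoldringKoskivirta2019_heckeFieldFinite`.
The crux's `r` has a model `rE` over a finite `E/ℚ_ℓ` (`exists_hasQlModel_holds`); for a controlled
`u` and a base-change parameter `β` there, the predicted polynomial is `charpoly r(Frob_u)`
(a prime above `u` and an arithmetic Frobenius exist), which equals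
`(charpoly rE(Frob_u)).map (E ⊆ ℚ̄_ℓ)` (`charpoly_conj`, `FramedRep.charpoly_baseChange`), whose
coefficients lie in `E`. [folklore] -/
theorem heckeFieldFinite_of_galoisRepOfUnitaryLDS (h : GaloisRepOfUnitaryLDS) :
    GoldringKoskivirta2019_heckeFieldFinite := by
  intro F₀ K _ _ _ _ _ cK hF₀ hK hc hKc N ℓ _ ι hcptK σ hLDS hℓ
  obtain ⟨r, -, hr⟩ := h F₀ K cK hF₀ hK hc hKc N ℓ ι hcptK σ hLDS hℓ
  obtain ⟨E, rE, hfd, P, hP⟩ := exists_hasQlModel_holds r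
  refine ⟨E, hfd, fun u β hu hu' hβ k ↦ ?_⟩
  obtain ⟨𝔓, h𝔓⟩ := HeightOneSpectrum.primesAbove_nonempty u
  obtain ⟨φ, hφ⟩ := HeightOneSpectrum.exists_isArithFrobAt_of_mem_primesAbove_holds h𝔓
  have hchar : FramedRep.charpoly r φ = arithFrobPolyOfSatake ι u.residueCard N β :=
    (hr u β hu hu' hβ).2 𝔓 h𝔓 φ hφ
  rw [← hchar, ← hP, charpoly_conj, FramedRep.charpoly_baseChange, Polynomial.coeff_map]
  exact SetLike.coe_mem _

/-- **K2 is the crux restricted to regular data, hence implied by the crux** (forget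
`d.IsRegular`).  The statement is verbatim `stub_regularDSGalois` of `Lines/Sketch.lean`.
[folklore] -/
theorem regularCase_of_galoisRepOfUnitaryLDS (h : GaloisRepOfUnitaryLDS) :
    ∀ (F₀ K : Type) [Field F₀] [NumberField F₀] [Field K] [NumberField K] [Algebra F₀ K]
      (cK : K ≃ₐ[F₀] K), IsTotallyReal F₀ → Module.finrank F₀ K = 2 → ∀ (hc : cK ≠ 1),
      IsTotallyComplex K → ∀ (N : ℕ) (ℓ : ℕ) [Fact ℓ.Prime] (ι : PadicAlgCl ℓ ≃+* ℂ)
      (hcptK : isCompact_glFiniteIntegralLevel N K)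
      (σ' : UnitaryGroup.CuspidalAutomorphicRepData F₀ K cK N hcptK),
      (∀ (w : {w : InfinitePlace K // w.IsComplex}) (hw : cK • w.1 = w.1),
        ∃ (p q : ℕ) (d : LDSDatum p q), d.IsRegular ∧
          UnitaryGroup.IsNondegenerateLimitOfDiscreteSeriesAt F₀ K cK N (StdForm.antidiagonal N)
            hcptK σ'.1 hw hc d) →
      (∀ u : HeightOneSpectrum (𝓞 K), ((ℓ : ℕ) : 𝓞 K) ∈ u.asIdeal →
        u.asIdeal.ramificationIdx ℤ = 1 ∧ UnitaryGroup.IsUnramifiedAt F₀ K cK N hcptK σ'.1 u) →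
      ∃ r : FramedGaloisRep K (PadicAlgCl ℓ) N, r.toGaloisRep.IsSemisimple ∧
        ∀ (u : HeightOneSpectrum (𝓞 K)) (β : Multiset ℂ), ((ℓ : ℕ) : 𝓞 K) ∉ u.asIdeal →
          (∀ u' : HeightOneSpectrum (𝓞 K), u'.asIdeal.under ℤ = u.asIdeal.under ℤ →
            u'.asIdeal.ramificationIdx ℤ = 1 ∧
              UnitaryGroup.IsUnramifiedAt F₀ K cK N hcptK σ'.1 u') →
          UnitaryGroup.HasBaseChangeSatakeAt F₀ K cK N hcptK σ'.1 u β →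
            r.IsUnramifiedAt u ∧
              r.HasFrobCharpolyAt u (arithFrobPolyOfSatake ι u.residueCard N β) :=
  fun F₀ K _ _ _ _ _ cK hF₀ hK hc hKc N ℓ _ ι hcptK σ' hDS hℓ ↦
    h F₀ K cK hF₀ hK hc hKc N ℓ ι hcptK σ' (fun w hw ↦ by
      obtain ⟨p, q, d, -, hd⟩ := hDS w hw
      exact ⟨p, q, d, hd⟩) hℓ

end Summit.Langlands.Langlands.Theorems.GaloisRepOfUnitaryLDS.Negative

end
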